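import Summits.BirchSwinnertonDyer.BirchSwinnertonDyer.Theorems.ResidualThetaTransportAtTwoPlusDualLayerNorms
import Summits.BirchSwinnertonDyer.BirchSwinnertonDyer.Theorems.ResidualThetaTransportAtTwoPlusDualLayerOmegaBezout
import HarnessLib

/-!
# Kim 2007 Prop. 3.15 steps (a), (b), (c) at FINITE LEVEL for a cofree rank-one dual pair: `(T·ω̃⁺_n)·S[p^J, ω_n] = S[p^J, ω̃⁻_n]`,
# `ω̃⁻_n·S[p^J, ω_n] = S[p^J, T·ω̃⁺_n]`, the Bezout decomposition `S[p^J, ω_n] ⊆ S[p^{J+ν}, T·ω̃⁺_n] + S[p^{J+ν}, ω̃⁻_n]`, and the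
# counting shell «honest ⊆ S[p^J, T·ω̃⁺_n] with ≥ p^{J·deg} elements ⟹ honest = S[p^J, T·ω̃⁺_n]»

Routes `ResidualThetaTransportAtTwo` (RTT, crux r201 `ResidualLambdaFormulaNegDiscAtTwo`, stmt-BirchSwinnertonDyer-23110) /
`ThetaPartnerAtTwo`. Seat `prover-bsd-wall-tp2-p2x-w3` g13; `--supports stmt-BirchSwinnertonDyer-23110` (θ-algebra + (d′)-shell of the ISO /
H-PLUSDUAL plan, lead 21:28Z). THEOREMS ONLY (no definition, no named fact, no instance, no `sorry`); PURE ALGEBRA; closes nothing.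

SETTING: a dual pair `IsDualPair p ψ toDual` (`T ↦ ψ`; for (R1)@2, `ψ = φ − 1`, `φ` = the local generator) with `X ≃ₗ[Λ] Λ`; the tree's
`cyclotomicOmega p n = (T+1)^{pⁿ} − 1 = T·ω̃⁺_n·ω̃⁻_n` (`cyclotomicOmegaPlus/Minus`) act on `S` as `aeval ψ (·)` (transposes
`toDual_aeval_X_smul`, generators distinguished by `…PlusDualLayerOmegaBezout`). B. D. Kim, Compositio 143 (2007), proof of Prop. 3.15:
* (c) «`ω⁻_n H⁻_n = H⁻_n[ω̃⁺_n]` (coranks + divisible)» — here, with the roles of `±` as in the PLUS theory of road T: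
  **`image_aeval_X_mul_cyclotomicOmegaPlus_eq`** `(T·ω̃⁺_n)(ψ) '' S[p^J, ω_n(ψ)] = S[p^J, ω̃⁻_n(ψ)]`,
  **`image_aeval_cyclotomicOmegaMinus_eq`** `ω̃⁻_n(ψ) '' S[p^J, ω_n(ψ)] = S[p^J, (T·ω̃⁺_n)(ψ)]`, by the cofree calculus (no coranks, no
  divisibility: exact counts `#S[p^J, D(ψ)] = p^{J deg D}`);
* (a) «`H_n = H_n[ω_n^∓] + H_n[ω̃_n^±]` since they are prime to each other» — at finite level the index is the Bezout `p`-power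
  `ν = (n/2+1)·((n+1)/2)` (`pow_mem_span_X_mul_cyclotomicOmegaPlus_cyclotomicOmegaMinus`): **`exists_add_of_mem_torsionBy_cyclotomicOmega`**
  every `s ∈ S[p^J, ω_n(ψ)]` is `a + b` with `a ∈ S[p^{J+ν}, (T·ω̃⁺_n)(ψ)]`, `b ∈ S[p^{J+ν}, ω̃⁻_n(ψ)]` (divisibility `p^ν·S[p^{J+ν}] = S[p^J]` +
  `A·Tω̃⁺ + B·ω̃⁻ = p^ν`);
* (b) «`Ê(m_n) ⊗ ℚ_p/ℤ_p = H_n[ω_n]` by annihilation + equal coranks + divisible» — the counting shell **`eq_torsionBy_ker_of_subset_of_le_ncard`**: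
  a subset of `S[p^J, Ψ]` with at least `p^{J·deg D}` elements IS `S[p^J, Ψ]`; the two arithmetic inputs it leaves — `ω⁺_n`-ANNIHILATION of
  the honest plus classes (Kim 3.14 at `2`) and their RANK `≥ deg(T·ω̃⁺_n)` (tree: `PlusRankGrowth.exists_indep_mod_two_signedLocalPoints` at
  even layers) — are the (d′) brick.

HONEST FRAMING: closes nothing; ISO / `hdual_Alt` NOT proved here; 23110 NOT proved; BSD is not proved by any of this.
References: [BDKim2007] Prop. 3.15 (proof, pp. 56–57), Prop. 3.14; [Pollack2003] §6.5; [Washington1997] §7.1, §13.2.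
-/

set_option autoImplicit false
-- D-0017: single-problem summit, so `Summit.BirchSwinnertonDyer.BirchSwinnertonDyer.…` repeats a namespace BY DESIGN.
set_option linter.dupNamespace false

noncomputable section

open scoped Classical
open Polynomial Literature.NumberTheory.EllipticCurves Literature.NumberTheory.EllipticCurves.IwasawaDual

namespace Summit.BirchSwinnertonDyer.BirchSwinnertonDyer.Theorems.ResidualThetaLayer.PlusDual

section Omega

variable {p : ℕ} [hp : Fact p.Prime]
variable {S : Type*} [AddCommGroup S] {ψ : AddMonoid.End S}
variable {X : Type*} [AddCommGroup X] [Module (PowerSeries ℤ_[p]) X]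
variable {toDual : X →+ (S →+ AddCircle (1 : ℚ))}

/-- The counting shell of Kim (b): **a subset of `S[p^J, Ψ]` with at least `p^{J·deg D}` elements is all of `S[p^J, Ψ]`** (for a transposed
pair `(q, Ψ)` with `(q) = (D)` distinguished, `#S[p^J, Ψ] = p^{J deg D}` is finite). With `P` = the honest plus-Kummer classes of layer `n`,
`Ψ = (T·ω̃⁺_n)(ψ)`: annihilation + rank ⟹ `P = S[p^J, T·ω̃⁺_n]`. [cite: BDKim2007, Prop. 3.15 (proof: «both are divisible, thus … =»)] -/
theorem eq_torsionBy_ker_of_subset_of_le_ncard (h : IsDualPair p ψ toDual) (e : X ≃ₗ[PowerSeries ℤ_[p]] PowerSeries ℤ_[p])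
    {D : ℤ_[p][X]} (hD : D.IsDistinguishedAt (IsLocalRing.maximalIdeal ℤ_[p])) {q : PowerSeries ℤ_[p]}
    (hqD : Ideal.span {q} = Ideal.span {(D : PowerSeries ℤ_[p])}) {Ψ : S →+ S}
    (hq : ∀ (x : X) (s : S), toDual (q • x) s = toDual x (Ψ s)) (J : ℕ) {P : Set S}
    (hP : P ⊆ {s : S | p ^ J • s = 0 ∧ Ψ s = 0}) (hcard : p ^ (J * D.natDegree) ≤ P.ncard) :
    P = {s : S | p ^ J • s = 0 ∧ Ψ s = 0} := by
  refine Set.eq_of_subset_of_ncard_le hP ?_ (finite_torsionBy_ker h e hD hqD Ψ hq J)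
  have hc : ({s : S | p ^ J • s = 0 ∧ Ψ s = 0} : Set S).ncard = p ^ (J * D.natDegree) := by
    rw [← Nat.card_coe_set_eq]
    exact natCard_torsionBy_ker_eq_pow h e hD hqD Ψ hq J
  rw [hc]; exact hcard

/-- Goal-directed form of the cofree calculus for a general `ψ` (the two sets supplied by membership criteria).
[cite: BDKim2007, Prop. 3.15 (proof)] -/
theorem image_eq_of_mem_iff' (h : IsDualPair p ψ toDual) (e : X ≃ₗ[PowerSeries ℤ_[p]] PowerSeries ℤ_[p])
    {Df Dg : ℤ_[p][X]} (hDf : Df.IsDistinguishedAt (IsLocalRing.maximalIdeal ℤ_[p]))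
    (hDg : Dg.IsDistinguishedAt (IsLocalRing.maximalIdeal ℤ_[p])) {f g : PowerSeries ℤ_[p]}
    (hf : Ideal.span {f} = Ideal.span {(Df : PowerSeries ℤ_[p])}) (hg : Ideal.span {g} = Ideal.span {(Dg : PowerSeries ℤ_[p])})
    {Ψf Ψg : S →+ S} (hΨf : ∀ (x : X) (s : S), toDual (f • x) s = toDual x (Ψf s))
    (hΨg : ∀ (x : X) (s : S), toDual (g • x) s = toDual x (Ψg s)) (J : ℕ) {A B : Set S}
    (hA : ∀ s, s ∈ A ↔ p ^ J • s = 0 ∧ Ψg (Ψf s) = 0) (hB : ∀ s, s ∈ B ↔ p ^ J • s = 0 ∧ Ψg s = 0) :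
    Ψf '' A = B := by
  have hA' : A = {s | p ^ J • s = 0 ∧ Ψg (Ψf s) = 0} := Set.ext fun s ↦ hA s
  have hB' : B = {s | p ^ J • s = 0 ∧ Ψg s = 0} := Set.ext fun s ↦ hB s
  rw [hA', hB']
  exact image_torsionBy_ker_comp_eq h e hDf hDg hf hg hΨf hΨg J

/-- Transposes of integer polynomials in `T`, generator form: `(aeval T P) = (↑(P.map ℤ→ℤ_p))` as ideals of `Λ`. [folklore] -/
theorem span_aeval_X_eq (P : ℤ[X]) :
    Ideal.span {Polynomial.aeval (PowerSeries.X : PowerSeries ℤ_[p]) P} =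
      Ideal.span {((P.map (Int.castRingHom ℤ_[p]) : ℤ_[p][X]) : PowerSeries ℤ_[p])} := by
  rw [aeval_X_eq_coe_map]

/-- Products of the `ω`-operators: `(P·Q)(ψ) s = P(ψ) (Q(ψ) s)`. [folklore] -/
theorem aeval_mul_apply (P Q : ℤ[X]) (s : S) :
    Polynomial.aeval ψ (P * Q) s = Polynomial.aeval ψ P (Polynomial.aeval ψ Q s) := by
  rw [map_mul]; rfl

/-- **Kim (c), plus form: `(T·ω̃⁺_n)(ψ) '' S[p^J, ω_n(ψ)] = S[p^J, ω̃⁻_n(ψ)]`** for a cofree rank-one dual pair — exact images, by the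
cofree calculus with the distinguished generators `T·ω̃⁺_n`, `ω̃⁻_n` (`T·ω̃⁺_n·ω̃⁻_n = ω_n`).
[cite: BDKim2007, Prop. 3.15 (proof, p. 56: «`ω⁻_n H⁻_n = H⁻_n[ω̃⁺_n]`»)] [cite: Pollack2003, §6.5] -/
theorem image_aeval_X_mul_cyclotomicOmegaPlus_eq (h : IsDualPair p ψ toDual) (e : X ≃ₗ[PowerSeries ℤ_[p]] PowerSeries ℤ_[p])
    (n J : ℕ) :
    (⇑(Polynomial.aeval ψ (Polynomial.X * cyclotomicOmegaPlus p n))) ''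
        {s : S | p ^ J • s = 0 ∧ Polynomial.aeval ψ (cyclotomicOmega p n) s = 0} =
      {s : S | p ^ J • s = 0 ∧ Polynomial.aeval ψ (cyclotomicOmegaMinus p n) s = 0} := by
  obtain ⟨hf, hg⟩ := isDistinguishedAt_map_X_mul_cyclotomicOmegaPlus_and_Minus p n
  refine image_eq_of_mem_iff' h e hf hg (span_aeval_X_eq _) (span_aeval_X_eq _)
    (toDual_aeval_X_smul h (Polynomial.X * cyclotomicOmegaPlus p n)) (toDual_aeval_X_smul h (cyclotomicOmegaMinus p n)) J
    (fun s ↦ ?_) (fun s ↦ Iff.rfl)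
  rw [Set.mem_setOf_eq]
  show _ ↔ _ ∧ Polynomial.aeval ψ (cyclotomicOmegaMinus p n) (Polynomial.aeval ψ (Polynomial.X * cyclotomicOmegaPlus p n) s) = 0
  rw [← aeval_mul_apply, mul_comm, X_mul_cyclotomicOmegaPlus_mul_cyclotomicOmegaMinus]

/-- **Kim (c), companion: `ω̃⁻_n(ψ) '' S[p^J, ω_n(ψ)] = S[p^J, (T·ω̃⁺_n)(ψ)]`.** [cite: BDKim2007, Prop. 3.15 (proof, p. 56)]
[cite: Pollack2003, §6.5] -/
theorem image_aeval_cyclotomicOmegaMinus_eq (h : IsDualPair p ψ toDual) (e : X ≃ₗ[PowerSeries ℤ_[p]] PowerSeries ℤ_[p])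
    (n J : ℕ) :
    (⇑(Polynomial.aeval ψ (cyclotomicOmegaMinus p n))) ''
        {s : S | p ^ J • s = 0 ∧ Polynomial.aeval ψ (cyclotomicOmega p n) s = 0} =
      {s : S | p ^ J • s = 0 ∧ Polynomial.aeval ψ (Polynomial.X * cyclotomicOmegaPlus p n) s = 0} := by
  obtain ⟨hf, hg⟩ := isDistinguishedAt_map_X_mul_cyclotomicOmegaPlus_and_Minus p n
  refine image_eq_of_mem_iff' h e hg hf (span_aeval_X_eq _) (span_aeval_X_eq _)
    (toDual_aeval_X_smul h (cyclotomicOmegaMinus p n)) (toDual_aeval_X_smul h (Polynomial.X * cyclotomicOmegaPlus p n)) J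
    (fun s ↦ ?_) (fun s ↦ Iff.rfl)
  rw [Set.mem_setOf_eq]
  show _ ↔ _ ∧ Polynomial.aeval ψ (Polynomial.X * cyclotomicOmegaPlus p n) (Polynomial.aeval ψ (cyclotomicOmegaMinus p n) s) = 0
  rw [← aeval_mul_apply, X_mul_cyclotomicOmegaPlus_mul_cyclotomicOmegaMinus]

/-- **Kim (c), minus forms: `(T·ω̃⁻_n)(ψ) '' S[p^J, ω_n] = S[p^J, ω̃⁺_n]` and `ω̃⁺_n(ψ) '' S[p^J, ω_n] = S[p^J, T·ω̃⁻_n]`.**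
[cite: BDKim2007, Prop. 3.15 (proof, p. 56)] [cite: Pollack2003, §6.5] -/
theorem image_aeval_X_mul_cyclotomicOmegaMinus_eq (h : IsDualPair p ψ toDual) (e : X ≃ₗ[PowerSeries ℤ_[p]] PowerSeries ℤ_[p])
    (n J : ℕ) :
    (⇑(Polynomial.aeval ψ (Polynomial.X * cyclotomicOmegaMinus p n))) ''
        {s : S | p ^ J • s = 0 ∧ Polynomial.aeval ψ (cyclotomicOmega p n) s = 0} =
      {s : S | p ^ J • s = 0 ∧ Polynomial.aeval ψ (cyclotomicOmegaPlus p n) s = 0} ∧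
    (⇑(Polynomial.aeval ψ (cyclotomicOmegaPlus p n))) ''
        {s : S | p ^ J • s = 0 ∧ Polynomial.aeval ψ (cyclotomicOmega p n) s = 0} =
      {s : S | p ^ J • s = 0 ∧ Polynomial.aeval ψ (Polynomial.X * cyclotomicOmegaMinus p n) s = 0} := by
  obtain ⟨hf, hg⟩ := isDistinguishedAt_map_X_mul_cyclotomicOmegaMinus_and_Plus p n
  have hωeq : Polynomial.X * cyclotomicOmegaMinus p n * cyclotomicOmegaPlus p n = cyclotomicOmega p n := by
    rw [← X_mul_cyclotomicOmegaPlus_mul_cyclotomicOmegaMinus]; ring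
  constructor
  · refine image_eq_of_mem_iff' h e hf hg (span_aeval_X_eq _) (span_aeval_X_eq _)
      (toDual_aeval_X_smul h (Polynomial.X * cyclotomicOmegaMinus p n)) (toDual_aeval_X_smul h (cyclotomicOmegaPlus p n)) J
      (fun s ↦ ?_) (fun s ↦ Iff.rfl)
    rw [Set.mem_setOf_eq]
    show _ ↔ _ ∧ Polynomial.aeval ψ (cyclotomicOmegaPlus p n) (Polynomial.aeval ψ (Polynomial.X * cyclotomicOmegaMinus p n) s) = 0
    rw [← aeval_mul_apply, mul_comm, hωeq]
  · refine image_eq_of_mem_iff' h e hg hf (span_aeval_X_eq _) (span_aeval_X_eq _)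
      (toDual_aeval_X_smul h (cyclotomicOmegaPlus p n)) (toDual_aeval_X_smul h (Polynomial.X * cyclotomicOmegaMinus p n)) J
      (fun s ↦ ?_) (fun s ↦ Iff.rfl)
    rw [Set.mem_setOf_eq]
    show _ ↔ _ ∧ Polynomial.aeval ψ (Polynomial.X * cyclotomicOmegaMinus p n) (Polynomial.aeval ψ (cyclotomicOmegaPlus p n) s) = 0
    rw [← aeval_mul_apply, hωeq]

/-- **Divisibility iterated: `p^ν · S[p^{J+ν}, Ψ] = S[p^J, Ψ]`** (pointwise form) for a transposed pair with distinguished generator.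
[cite: BDKim2007, Prop. 3.15 (proof: «Since `H⁻_n` is divisible …»)] -/
theorem exists_pow_nsmul_eq_of_mem_torsionBy_ker (h : IsDualPair p ψ toDual) (e : X ≃ₗ[PowerSeries ℤ_[p]] PowerSeries ℤ_[p])
    {D : ℤ_[p][X]} (hD : D.IsDistinguishedAt (IsLocalRing.maximalIdeal ℤ_[p])) {q : PowerSeries ℤ_[p]}
    (hqD : Ideal.span {q} = Ideal.span {(D : PowerSeries ℤ_[p])}) {Ψ : S →+ S}
    (hq : ∀ (x : X) (s : S), toDual (q • x) s = toDual x (Ψ s)) (ν J : ℕ) {s : S} (hs : p ^ J • s = 0 ∧ Ψ s = 0) :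
    ∃ s' : S, (p ^ (J + ν) • s' = 0 ∧ Ψ s' = 0) ∧ p ^ ν • s' = s := by
  induction ν generalizing J s with
  | zero => exact ⟨s, by simpa using hs, by rw [pow_zero, one_smul]⟩
  | succ ν ih =>
    -- one step of divisibility at level `J + ν`, then the induction hypothesis
    obtain ⟨t, ht, rfl⟩ := ih J hs
    have hmem : t ∈ (fun s : S ↦ p • s) '' {s : S | p ^ (J + ν + 1) • s = 0 ∧ Ψ s = 0} := by
      rw [nsmul_image_torsionBy_ker_succ_eq h e hD hqD hq (J + ν)]; exact ht
    obtain ⟨t', ht', rfl⟩ := hmem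
    refine ⟨t', by rw [show J + (ν + 1) = J + ν + 1 from by omega]; exact ht', ?_⟩
    rw [pow_succ, mul_smul]

/-- **Kim (a) at finite level — the Bezout decomposition.** Every `s ∈ S[p^J, ω_n(ψ)]` is `a + b` with
`a ∈ S[p^{J+ν}, (T·ω̃⁺_n)(ψ)]` and `b ∈ S[p^{J+ν}, ω̃⁻_n(ψ)]`, `ν = (n/2+1)·((n+1)/2)`: lift `s = p^ν s'` inside `S[p^{J+ν}, ω_n]`
(divisibility) and split `p^ν = A·Tω̃⁺_n + B·ω̃⁻_n` (`pow_mem_span_X_mul_cyclotomicOmegaPlus_cyclotomicOmegaMinus`):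
`a = B(ψ)(ω̃⁻_n(ψ) s')`, `b = A(ψ)((Tω̃⁺_n)(ψ) s')`. [cite: BDKim2007, Prop. 3.15 (proof, p. 56: «`H⁻_n = H⁻_n[ω⁻_n] + H⁻_n[ω̃⁺_n]`»)] -/
theorem exists_add_of_mem_torsionBy_cyclotomicOmega (h : IsDualPair p ψ toDual) (e : X ≃ₗ[PowerSeries ℤ_[p]] PowerSeries ℤ_[p])
    (n J : ℕ) {s : S} (hs : p ^ J • s = 0 ∧ Polynomial.aeval ψ (cyclotomicOmega p n) s = 0) :
    ∃ a b : S, s = a + b ∧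
      (p ^ (J + (n / 2 + 1) * ((n + 1) / 2)) • a = 0 ∧ Polynomial.aeval ψ (Polynomial.X * cyclotomicOmegaPlus p n) a = 0) ∧
      (p ^ (J + (n / 2 + 1) * ((n + 1) / 2)) • b = 0 ∧ Polynomial.aeval ψ (cyclotomicOmegaMinus p n) b = 0) := by
  set ν := (n / 2 + 1) * ((n + 1) / 2) with hν
  -- divisibility inside `S[·, ω_n]`
  obtain ⟨s', ⟨hs'p, hs'ω⟩, rfl⟩ := exists_pow_nsmul_eq_of_mem_torsionBy_ker h e (isDistinguishedAt_map_cyclotomicOmega p n)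
    (span_aeval_X_eq _) (toDual_aeval_X_smul h (cyclotomicOmega p n)) ν J hs
  -- Bezout
  obtain ⟨A, B, hAB⟩ := Ideal.mem_span_pair.mp (pow_mem_span_X_mul_cyclotomicOmegaPlus_cyclotomicOmegaMinus p n)
  have hops : Polynomial.aeval ψ A * Polynomial.aeval ψ (Polynomial.X * cyclotomicOmegaPlus p n) +
      Polynomial.aeval ψ B * Polynomial.aeval ψ (cyclotomicOmegaMinus p n) = ((p ^ ν : ℕ) : AddMonoid.End S) := by
    rw [← map_mul, ← map_mul, ← map_add, hAB, map_pow, map_natCast, Nat.cast_pow]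
  refine ⟨Polynomial.aeval ψ B (Polynomial.aeval ψ (cyclotomicOmegaMinus p n) s'),
    Polynomial.aeval ψ A (Polynomial.aeval ψ (Polynomial.X * cyclotomicOmegaPlus p n) s'), ?_, ⟨?_, ?_⟩, ⟨?_, ?_⟩⟩
  · -- `p^ν s' = (A·Tω̃⁺ + B·ω̃⁻)(ψ) s'`
    have := congrArg (fun Θ : AddMonoid.End S ↦ Θ s') hops
    rw [AddMonoid.End.natCast_apply] at this
    rw [← this, add_comm]
    rfl
  · rw [← map_nsmul, ← map_nsmul, hs'p, map_zero, map_zero]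
  · show (Polynomial.aeval ψ (Polynomial.X * cyclotomicOmegaPlus p n) * (Polynomial.aeval ψ B *
      Polynomial.aeval ψ (cyclotomicOmegaMinus p n))) s' = 0
    rw [← map_mul, ← map_mul, show Polynomial.X * cyclotomicOmegaPlus p n * (B * cyclotomicOmegaMinus p n) = B * cyclotomicOmega p n from by
      rw [← X_mul_cyclotomicOmegaPlus_mul_cyclotomicOmegaMinus]; ring, aeval_mul_apply,
      show Polynomial.aeval ψ (cyclotomicOmega p n) s' = 0 from hs'ω, map_zero]
  · rw [← map_nsmul, ← map_nsmul, hs'p, map_zero, map_zero]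
  · show (Polynomial.aeval ψ (cyclotomicOmegaMinus p n) * (Polynomial.aeval ψ A *
      Polynomial.aeval ψ (Polynomial.X * cyclotomicOmegaPlus p n))) s' = 0
    rw [← map_mul, ← map_mul, show cyclotomicOmegaMinus p n * (A * (Polynomial.X * cyclotomicOmegaPlus p n)) = A * cyclotomicOmega p n from by
      rw [← X_mul_cyclotomicOmegaPlus_mul_cyclotomicOmegaMinus]; ring, aeval_mul_apply,
      show Polynomial.aeval ψ (cyclotomicOmega p n) s' = 0 from hs'ω, map_zero]

end Omega

end Summit.BirchSwinnertonDyer.BirchSwinnertonDyer.Theorems.ResidualThetaLayer.PlusDual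

end
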